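import Summits.Ventures.PercRepro.RankLevelSetIndepCD

/-! # RankLevelSetIndepSRI — THE SLICE-RAYLEIGH PROPERTY (SRI) OF THE INDEPENDENCE POLYNOMIAL, AND ITS FIBRE
DECOMPOSITION INTO NEAR-MIDDLE AVOID-SET (★★) INEQUALITIES (night-1 g27; dossier §39.5–39.6)

For a finite matroid `M` and two elements `y ≠ e` put `I_p^A = sliceCount M y e A p = #{T ⊆ E ∖ {y, e} : #T = p, T ∪ A
independent}` for `A ⊆ {y, e}`. **(SRI)** (`IndepSRI M`, a `Prop`, NOT asserted): `I_p^∅ · I_p^{ye} ≤ I_p^y · I_p^e` for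
every `p` — every coefficient `[t^p] f_M(t·1, u, v)` of the independence polynomial with the other elements weighted `t`
is a Rayleigh (real stable) polynomial in the variables `u, v` of `y, e`. CENSUS (night-1 g27, own exact code): all
383,172 matroids on 9 elements (13,794,192 `(M, {y, e})` instances), all `n ≤ 8`, theta graphs ≤ 16 edges, random GF(2/3/5)
matroids n ≤ 13, series extensions ≤ 13 — 0 failures, while the classical basis negative correlation (the top HOMOGENEOUS
slice) fails at `n = 8`; the weighted form is census-clean and monomial-positive on `n ≤ 7`. THE FIBRES: grouping the
pairs `(A, B)` counted by `I_p^∅ · I_p^{ye}` and by `I_p^y · I_p^e` by `(U, W) = (A ∪ B, A ∩ B)`, `V = U ∖ W` (`#V = 2m`,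
`m = p − #W`), `A = W ∪ A₀`, `B = W ∪ (V ∖ A₀)`: the left fibre counts the `A₀ ⊆ V` (`#A₀ = m`) with `W ∪ A₀` and
`W ∪ (V ∖ A₀) ∪ {y, e}` independent, the right one those with `W ∪ A₀ ∪ {y}` and `W ∪ (V ∖ A₀) ∪ {e}` independent — the
two sides of the avoid-`e` (★★) at the near-middle level for the minor `(M / W) | (V ∪ {y, e})` at `y`
(`RelSRIMid M`, stated in `M`; a `Prop`, NOT asserted). **`indepSRI_of_relSRIMid : RelSRIMid M → IndepSRI M`** — the
proof is the fibrewise comparison of `RankLevelSetIndepCD`, with both fibre sides of the same size. Every declaration has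
a docstring; imports: the cell's own modules and Mathlib only. Axioms: standard. -/

namespace PercRepro

open Set Matroid Finset

variable {α : Type} (M : Matroid α) [M.Finite]

omit [M.Finite] in
/-- `I_p^A = #{T ⊆ E ∖ {y, e} : #T = p, T ∪ A independent}` (`A ⊆ {y, e}`): the `(y, e)`-slices of the independence
polynomial at outer size `p`. -/
noncomputable def sliceCount (y e : α) (A : Set α) (p : ℕ) : ℕ :=
  {T : Set α | T ⊆ M.E \ {y, e} ∧ T.ncard = p ∧ M.Indep (T ∪ A)}.ncard

omit [M.Finite] in
/-- **(SRI)** (a `Prop`, NOT asserted): `I_p^∅ · I_p^{ye} ≤ I_p^y · I_p^e` for all `y ≠ e` in `E` and every `p`. -/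
def IndepSRI : Prop :=
  ∀ y ∈ M.E, ∀ e ∈ M.E, y ≠ e → ∀ p : ℕ,
    sliceCount M y e ∅ p * sliceCount M y e {y, e} p ≤ sliceCount M y e {y} p * sliceCount M y e {e} p

omit [M.Finite] in
/-- The `A₀`-sets of a fibre: `A₀ ⊆ V` with `#A₀ = m`, `W ∪ A₀ ∪ A` independent and `W ∪ (V ∖ A₀) ∪ A'` independent. -/
def sriFibre (W V A A' : Set α) (m : ℕ) : Set (Set α) :=
  {A₀ : Set α | A₀ ⊆ V ∧ A₀.ncard = m ∧ M.Indep (W ∪ A₀ ∪ A) ∧ M.Indep (W ∪ (V \ A₀) ∪ A')}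

omit [M.Finite] in
/-- **The relative near-middle avoid-set (★★)** (a `Prop`, NOT asserted): for `y ≠ e`, disjoint `W, V ⊆ E ∖ {y, e}` with
`#V = 2m`, `#{A₀ ⊆ V : #A₀ = m, W ∪ A₀ and W ∪ (V ∖ A₀) ∪ {y, e} independent} ≤ #{A₀ ⊆ V : #A₀ = m, W ∪ A₀ ∪ {y} and
W ∪ (V ∖ A₀) ∪ {e} independent}` — for the minor `(M / W) | (V ∪ {y, e})` this reads `N_m(¬y, ¬e) ≤ N_{m+1}(y, ¬e)`, the
avoid-`e` form of (★★) at `y` at the last level below the middle. -/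
def RelSRIMid : Prop :=
  ∀ y ∈ M.E, ∀ e ∈ M.E, y ≠ e → ∀ W V : Set α, W ⊆ M.E \ {y, e} → V ⊆ M.E \ {y, e} → Disjoint W V →
    ∀ m : ℕ, V.ncard = 2 * m →
      (sriFibre M W V ∅ {y, e} m).ncard ≤ (sriFibre M W V {y} {e} m).ncard

section Finsets

variable [DecidableEq α]

omit [M.Finite] in
open Classical in
/-- The `Finset` of the `m`-subsets `T` of `s` with `T ∪ A` independent. -/
noncomputable def sliceFinset (s : Finset α) (A : Set α) (m : ℕ) : Finset (Finset α) :=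
  s.powerset.filter (fun T : Finset α => T.card = m ∧ M.Indep (↑T ∪ A))

omit [M.Finite] in
open Classical in
/-- The fibre sets over a `Finset` ground set, as a `Finset` of `Finset`s. -/
noncomputable def sriFibreFinset (W V : Finset α) (A A' : Set α) (m : ℕ) : Finset (Finset α) :=
  V.powerset.filter (fun A₀ : Finset α => A₀.card = m ∧ M.Indep (↑(W ∪ A₀) ∪ A) ∧ M.Indep (↑(W ∪ (V \ A₀)) ∪ A'))

omit [M.Finite] [DecidableEq α] in
open Classical in
/-- `I_p^A` as a `Finset` count over `s = E ∖ {y, e}`. -/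
lemma sliceCount_eq_card (y e : α) (A : Set α) (s : Finset α) (hs : (↑s : Set α) = M.E \ {y, e}) (p : ℕ) :
    sliceCount M y e A p = (sliceFinset M s A p).card := by
  unfold sliceCount sliceFinset
  rw [← hs, ncard_subsets_eq_card_filter s (fun T : Set α => T.ncard = p ∧ M.Indep (T ∪ A))]
  refine congrArg Finset.card ?_
  ext T
  simp only [Finset.mem_filter, Finset.mem_powerset, Set.ncard_coe_finset]

omit [M.Finite] in
open Classical in
/-- The fibre sets as a `Finset` count. -/
lemma ncard_sriFibre_eq (W V : Finset α) (A A' : Set α) (m : ℕ) :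
    (sriFibre M ↑W ↑V A A' m).ncard = (sriFibreFinset M W V A A' m).card := by
  unfold sriFibre sriFibreFinset
  rw [ncard_subsets_eq_card_filter V
    (fun A₀ : Set α => A₀.ncard = m ∧ M.Indep (↑W ∪ A₀ ∪ A) ∧ M.Indep (↑W ∪ (↑V \ A₀) ∪ A'))]
  refine congrArg Finset.card ?_
  ext A₀
  simp only [Finset.mem_filter, Finset.mem_powerset, Set.ncard_coe_finset, Finset.coe_union, Finset.coe_sdiff]

omit [M.Finite] in
open Classical in
/-- **The fibre over `(U, W)` is a set of `A₀`'s** (both sides of size `m₀ = m − #W`, `#(U ∖ W) = 2 m₀`): the pairs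
`(A, B)` of `m`-sets with `A ∪ A`, `B ∪ A'` independent, `A ∪ B = U`, `A ∩ B = W`, correspond by `A ↦ A ∖ W` to the
`A₀ ⊆ U ∖ W` of `sriFibre`. -/
lemma sri_fibre_card_eq (s U W : Finset α) (A A' : Set α) (m m₀ : ℕ) (hm : m = W.card + m₀)
    (hV : (U \ W).card = 2 * m₀) (hWU : W ⊆ U) (hUs : U ⊆ s) :
    ((sliceFinset M s A m ×ˢ sliceFinset M s A' m).filter
      (fun p : Finset α × Finset α => (p.1 ∪ p.2, p.1 ∩ p.2) = (U, W))).card =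
      (sriFibre M ↑W ↑(U \ W) A A' m₀).ncard := by
  rw [ncard_sriFibre_eq]
  have hWs : W ⊆ s := hWU.trans hUs
  have hVs : U \ W ⊆ s := Finset.sdiff_subset.trans hUs
  refine Finset.card_nbij' (fun p => p.1 \ W) (fun A₀ => (W ∪ A₀, W ∪ ((U \ W) \ A₀))) ?_ ?_ ?_ ?_
  · rintro ⟨A₁, B⟩ hp
    rw [Finset.mem_coe, Finset.mem_filter, Finset.mem_product] at hp
    obtain ⟨⟨hA, hB⟩, hf⟩ := hp
    simp only [sliceFinset, Finset.mem_filter, Finset.mem_powerset] at hA hB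
    simp only [Prod.mk.injEq] at hf
    obtain ⟨hU, hW⟩ := hf
    have hWA : W ⊆ A₁ := by rw [← hW]; exact Finset.inter_subset_left
    have hAU : A₁ ⊆ U := by rw [← hU]; exact Finset.subset_union_left
    have hAeq : W ∪ (A₁ \ W) = A₁ := Finset.union_sdiff_of_subset hWA
    have hBeq : W ∪ ((U \ W) \ (A₁ \ W)) = B := fibre_second_eq hU hW
    unfold sriFibreFinset
    rw [Finset.mem_coe, Finset.mem_filter, Finset.mem_powerset]
    refine ⟨Finset.sdiff_subset_sdiff hAU le_rfl, ?_, ?_, ?_⟩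
    · rw [Finset.card_sdiff, Finset.inter_eq_left.mpr hWA, hA.2.1]; omega
    · rw [hAeq]; exact hA.2.2
    · rw [hBeq]; exact hB.2.2
  · intro A₀ hA₀
    unfold sriFibreFinset at hA₀
    rw [Finset.mem_coe, Finset.mem_filter, Finset.mem_powerset] at hA₀
    obtain ⟨hA₀V, hA₀card, hind₁, hind₂⟩ := hA₀
    have hdisj₀ : Disjoint W A₀ := by
      refine Finset.disjoint_left.mpr (fun x hxW hxA => ?_)
      exact (Finset.mem_sdiff.mp (hA₀V hxA)).2 hxW
    have hdisj₁ : Disjoint W ((U \ W) \ A₀) := by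
      refine Finset.disjoint_left.mpr (fun x hxW hx => ?_)
      exact (Finset.mem_sdiff.mp (Finset.mem_sdiff.mp hx).1).2 hxW
    rw [Finset.mem_coe, Finset.mem_filter, Finset.mem_product]
    refine ⟨⟨?_, ?_⟩, ?_⟩
    · unfold sliceFinset
      rw [Finset.mem_filter, Finset.mem_powerset]
      refine ⟨Finset.union_subset hWs (hA₀V.trans hVs), ?_, hind₁⟩
      rw [Finset.card_union_of_disjoint hdisj₀, hA₀card, hm]
    · unfold sliceFinset
      rw [Finset.mem_filter, Finset.mem_powerset]
      refine ⟨Finset.union_subset hWs (Finset.sdiff_subset.trans hVs), ?_, hind₂⟩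
      rw [Finset.card_union_of_disjoint hdisj₁, Finset.card_sdiff, Finset.inter_eq_left.mpr hA₀V, hA₀card, hV]
      omega
    · simp only [Prod.mk.injEq]
      exact ⟨fibre_union_eq hWU hA₀V, fibre_inter_eq hA₀V⟩
  · rintro ⟨A₁, B⟩ hp
    rw [Finset.mem_coe, Finset.mem_filter, Finset.mem_product] at hp
    obtain ⟨-, hf⟩ := hp
    simp only [Prod.mk.injEq] at hf
    obtain ⟨hU, hW⟩ := hf
    have hWA : W ⊆ A₁ := by rw [← hW]; exact Finset.inter_subset_left
    have hAeq : W ∪ (A₁ \ W) = A₁ := Finset.union_sdiff_of_subset hWA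
    have hBeq : W ∪ ((U \ W) \ (A₁ \ W)) = B := fibre_second_eq hU hW
    simp only [hAeq, hBeq]
  · intro A₀ hA₀
    unfold sriFibreFinset at hA₀
    rw [Finset.mem_coe, Finset.mem_filter, Finset.mem_powerset] at hA₀
    have hdisj₀ : Disjoint W A₀ := by
      refine Finset.disjoint_left.mpr (fun x hxW hxA => ?_)
      exact (Finset.mem_sdiff.mp (hA₀.1 hxA)).2 hxW
    simp only
    rw [Finset.union_sdiff_cancel_left hdisj₀]

end Finsets

/-- **THE RELATIVE AVOID-SET (★★) FOR THE MINORS IMPLIES (SRI)**: `RelSRIMid M → IndepSRI M`. Group the pairs `(A, B)`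
counted by `I_p^∅ · I_p^{ye}` and by `I_p^y · I_p^e` by `(A ∪ B, A ∩ B)`; over each `(U, W)` the two fibres are the two
sides of the relative inequality for `W` and `V = U ∖ W` (`#V = 2m`, `m = p − #W`). -/
theorem indepSRI_of_relSRIMid (h : RelSRIMid M) : IndepSRI M := by
  classical
  intro y hy e he hye p
  set s : Finset α := (M.ground_finite.toFinset.erase y).erase e with hs
  have hs_coe : (↑s : Set α) = M.E \ {y, e} := by
    ext x
    simp only [hs, Finset.coe_erase, M.ground_finite.coe_toFinset, Set.mem_sdiff, Set.mem_singleton_iff,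
      Set.mem_insert_iff, not_or]
    tauto
  rw [sliceCount_eq_card M y e ∅ s hs_coe, sliceCount_eq_card M y e {y, e} s hs_coe,
    sliceCount_eq_card M y e {y} s hs_coe, sliceCount_eq_card M y e {e} s hs_coe,
    ← Finset.card_product, ← Finset.card_product]
  set f : Finset α × Finset α → Finset α × Finset α := fun p => (p.1 ∪ p.2, p.1 ∩ p.2) with hfdef
  set t : Finset (Finset α × Finset α) := s.powerset ×ˢ s.powerset with htdef
  have hmem : ∀ {A A' : Set α} (q : Finset α × Finset α), q ∈ sliceFinset M s A p ×ˢ sliceFinset M s A' p →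
      f q ∈ t := by
    intro A A' q hq
    rw [Finset.mem_product] at hq
    obtain ⟨hA, hB⟩ := hq
    simp only [sliceFinset, Finset.mem_filter, Finset.mem_powerset] at hA hB
    simp only [htdef, hfdef, Finset.mem_product, Finset.mem_powerset]
    exact ⟨Finset.union_subset hA.1 hB.1, (Finset.inter_subset_left).trans hA.1⟩
  rw [Finset.card_eq_sum_card_fiberwise (fun q hq => hmem q hq),
    Finset.card_eq_sum_card_fiberwise (fun q hq => hmem q hq)]
  refine Finset.sum_le_sum (fun UW _ => ?_)
  obtain ⟨U, W⟩ := UW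
  by_cases hL : ((sliceFinset M s ∅ p ×ˢ sliceFinset M s {y, e} p).filter (fun q => f q = (U, W))).card = 0
  · rw [hL]; exact Nat.zero_le _
  obtain ⟨⟨A₁, B⟩, hAB⟩ := Finset.card_pos.mp (Nat.pos_of_ne_zero hL)
  rw [Finset.mem_filter, Finset.mem_product] at hAB
  obtain ⟨⟨hA, hB⟩, hf⟩ := hAB
  simp only [sliceFinset, Finset.mem_filter, Finset.mem_powerset] at hA hB
  simp only [hfdef, Prod.mk.injEq] at hf
  obtain ⟨hU, hW⟩ := hf
  have hWU : W ⊆ U := by rw [← hU, ← hW]; exact Finset.inter_subset_left.trans Finset.subset_union_left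
  have hWB : W ⊆ B := by rw [← hW]; exact Finset.inter_subset_right
  have hUs : U ⊆ s := by rw [← hU]; exact Finset.union_subset hA.1 hB.1
  have hcardUW : U.card + W.card = A₁.card + B.card := by
    rw [← hU, ← hW]; exact Finset.card_union_add_card_inter A₁ B
  have hWp : W.card ≤ p := by
    have := Finset.card_le_card hWB; omega
  have hVcard : (U \ W).card = 2 * (p - W.card) := by
    rw [Finset.card_sdiff, Finset.inter_eq_left.mpr hWU]; omega
  have hL' := sri_fibre_card_eq M s U W ∅ {y, e} p (p - W.card) (by omega) hVcard hWU hUs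
  have hR' := sri_fibre_card_eq M s U W {y} {e} p (p - W.card) (by omega) hVcard hWU hUs
  simp only [hfdef]
  rw [hL', hR']
  refine h y hy e he hye ↑W ↑(U \ W) ?_ ?_ ?_ (p - W.card) ?_
  · rw [← hs_coe]; exact Finset.coe_subset.mpr (hWU.trans hUs)
  · rw [← hs_coe]; exact Finset.coe_subset.mpr (Finset.sdiff_subset.trans hUs)
  · rw [Finset.coe_sdiff]; exact Set.disjoint_sdiff_right
  · rw [Set.ncard_coe_finset, hVcard]

end PercRepro
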